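import Summits.CriticalPhenomena.PercolationContinuityZ3.Theorems.PercNearOneGluingNoHeavyQuantFlowAtTMonotone
import HarnessLib

/-!
# QUANT lane R8, T-DEC: small flow facts for the blob step — the flow cone is closed under finite sums, and a BLOB UNIT
# `c·{l, l+a; g}` whose low lies above half the un-raised target rides its own twin (`LawDec.flowAtT_blobUnit`)

builds on p205010 (kernel theorem, internal audit signed; external expert review pending)

Support file (`--supports stmt-CriticalPhenomena-4575`), QUANT lane seat prim-quant-arm-1 (gen 40), rung R8 of
`run/shared/lean/prim/quant/LADDER.md`.  Theorems only (no definitions), standard axioms, no sorries.  Part 1 of 2: the tools of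
`…QuantGateMoveBlobGiantData` (`decAtT_gateMoveBlob_of_critE`: the blob gate move / window form CW from criterion E of the partner law at ONE
layer).  Uses typer g23's cone property `FlowAtT.add` (`…QuantFlowAtTMonotone`).

* `LawDec.flowAtT_zero` — the zero measure is flow-feasible.
* `LawDec.flowAtT_finset_sum` — finite sums of flow-feasible measures are flow-feasible.
* **`LawDec.flowAtT_blobUnit`** — `0 < y < 1`, `0 ≤ g ≤ 1`, `y ≤ g`, `1 ≤ a`, `c ≥ 0`, `l ≤ j`, `2l < t ≤ 2l + ag` ⟹ `c·{l, l+a; g}` is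
  `FlowAtT y t j N` (`l + a ≤ N` when `c > 0`): the twin is a giant (`y ≤ g`) or a mid with minimal gate `max(ρ, y² + (1−y)ρ) ≤ g`
  (`ρ = (t − 2l)/a ≤ g`), so the low uses at most `g/(1−g)` of twin mass per unit — at most the twin's own mass.  (The NEW lows
  `S ≤ 2l < t` of the unshifted copy in the blob step are exactly of this kind: `t − S = ag(1−z) ≤ ag`.)
* `LawDec.sum_mul_indicator_shift` — `Σ_{l<N} F l·[h = l + a] = [a ≤ h]·F(h − a)` for `F` supported below `N`.

[this work]; flow form: prim-quant-stmt g22–g26 (this lane).  Nothing here is cited as a published result.  The gluing rows served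
[cite: KozmaNitzan2024, Conjecture 3 (p. 15)]; product measure [cite: Grimmett1999, §1.3 p. 10].
-/

noncomputable section

namespace Summit.CriticalPhenomena.PercolationContinuityZ3.Theorems

namespace Quant

open Finset

/-- the two-point law `{lo, hi; g}` (as in `…QuantLawDEC`) -/
local notation3 "TP[" lo ", " hi ", " g ", " h "]" =>
  (g : ℝ) * (if (h : ℕ) = (hi : ℕ) then (1 : ℝ) else 0) + (1 - (g : ℝ)) * (if (h : ℕ) = (lo : ℕ) then (1 : ℝ) else 0)

namespace LawDec

/-! ### Small flow facts -/

/-- the zero measure is flow-feasible (zero flow). [this work] -/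
theorem flowAtT_zero (x T : ℝ) (j' M : ℕ) : FlowAtT x T j' M (fun _ => 0) := by
  refine ⟨fun _ _ => 0, fun _ _ => le_rfl, fun l h hp => absurd hp (lt_irrefl 0), fun l _ _ => by simp, fun h _ _ => by simp⟩

/-- **finite sums of flow-feasible measures are flow-feasible** (the cone property `FlowAtT.add` iterated). [this work] -/
theorem flowAtT_finset_sum {ι : Type*} (x T : ℝ) (j' M : ℕ) (s : Finset ι) (μ : ι → ℕ → ℝ)
    (h : ∀ i ∈ s, FlowAtT x T j' M (μ i)) : FlowAtT x T j' M (fun k => ∑ i ∈ s, μ i k) := by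
  classical
  induction s using Finset.induction_on with
  | empty =>
    have e : (fun k : ℕ => ∑ i ∈ (∅ : Finset ι), μ i k) = fun _ => 0 := by funext k; simp
    rw [e]; exact flowAtT_zero x T j' M
  | @insert i s hi IH =>
    have h1 : FlowAtT x T j' M (μ i) := h i (Finset.mem_insert_self i s)
    have h2 := IH (fun k hk => h k (Finset.mem_insert_of_mem hk))
    have e : (fun k : ℕ => ∑ l ∈ insert i s, μ l k) = fun k => μ i k + ∑ l ∈ s, μ l k := by
      funext k; rw [Finset.sum_insert hi]
    rw [e]; exact FlowAtT.add h1 h2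

/-- **a blob unit whose low lies above half the un-raised target is flow-feasible on its own twin**: `0 < y < 1`, `0 ≤ g ≤ 1`, `y ≤ g`,
`1 ≤ a`, `c ≥ 0`, `l ≤ j`, `2l < t ≤ 2l + ag` ⟹ `c·{l, l+a; g}` is `FlowAtT y t j N` (`l + a ≤ N` when `c > 0`): the pair `{l, l+a}` is a
giant pair (`y ≤ g`) or a mid pair with minimal gate `max(ρ, y² + (1−y)ρ) ≤ g`, `ρ = (t − 2l)/a ≤ g`, so the low's usage of the twin is at most
`g/(1−g)` per unit, i.e. at most the twin's own mass. [this work] -/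
theorem flowAtT_blobUnit (y g t c : ℝ) (j N l a : ℕ) (hy0 : 0 < y) (hy1 : y < 1) (hg0 : 0 ≤ g) (hg1 : g ≤ 1) (hyg : y ≤ g)
    (ha : 1 ≤ a) (hc : 0 ≤ c) (hlj : l ≤ j) (hlN : 0 < c → l + a ≤ N)
    (hlow : 2 * (l : ℝ) < t) (hcred : t ≤ 2 * (l : ℝ) + (a : ℝ) * g) :
    FlowAtT y t j N (fun h => c * TP[l, l + a, g, h]) := by
  classical
  have ha0 : (0 : ℝ) < a := by exact_mod_cast (Nat.lt_of_lt_of_le Nat.zero_lt_one ha)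
  have hag : (a : ℝ) * g ≤ a := by nlinarith
  -- the twin `l + a` is never a `t`-low
  have htwin : ¬ (2 * ((l + a : ℕ) : ℝ) < t) := by
    push_cast; intro hlt; nlinarith
  have hTP0 : ∀ h, 0 ≤ c * TP[l, l + a, g, h] := fun h =>
    mul_nonneg hc (add_nonneg (mul_nonneg hg0 (by split_ifs <;> norm_num)) (mul_nonneg (by linarith) (by split_ifs <;> norm_num)))
  by_cases hcg : c * (1 - g) = 0
  · -- no low mass: the zero flow
    refine ⟨fun _ _ => 0, fun _ _ => le_rfl, fun l' h' hp => absurd hp (lt_irrefl 0), fun l' hl' hlow' => ?_, fun h' _ _ => ?_⟩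
    · beta_reduce
      rw [Finset.sum_const_zero]
      have hne : l' ≠ l + a := by rintro rfl; exact htwin hlow'
      rw [if_neg hne, mul_zero, zero_add]
      by_cases hl'l : l' = l
      · rw [if_pos hl'l, mul_one, hcg]
      · rw [if_neg hl'l, mul_zero, mul_zero]
    · beta_reduce
      simp only [mul_zero, Finset.sum_const_zero]; exact hTP0 h'
  · have hcpos : 0 < c := lt_of_le_of_ne hc (fun h0 => hcg (by rw [← h0, zero_mul]))
    have hg1' : g < 1 := lt_of_le_of_ne hg1 (fun h1 => hcg (by rw [h1, sub_self, mul_zero]))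
    have hlaN : l + a ≤ N := hlN hcpos
    -- the pair's usage is at most `g/(1−g)`
    have huse : usage y t j l (l + a) * (1 - g) ≤ g := by
      simp only [usage, gateOf]
      by_cases hgi : j + 1 ≤ l + a
      · rw [if_pos hgi]
        have h1y : 0 < 1 - y := by linarith
        rw [div_mul_eq_mul_div, div_le_iff₀ h1y]; nlinarith
      · rw [if_neg hgi]
        have hcast : (((l + a : ℕ) : ℝ) - l) = a := by push_cast; ring
        have hρ : (t - 2 * (l : ℝ)) / (((l + a : ℕ) : ℝ) - l) ≤ g := by
          rw [hcast, div_le_iff₀ ha0]; linarith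
        have hρ0 : 0 ≤ (t - 2 * (l : ℝ)) / (((l + a : ℕ) : ℝ) - l) := by
          rw [hcast]; exact div_nonneg (by linarith) ha0.le
        have hpg : pairGate y t l (l + a) ≤ g := by
          simp only [pairGate]
          refine max_le hρ ?_
          nlinarith
        have h1pg : 0 < 1 - pairGate y t l (l + a) := by linarith
        rw [div_mul_eq_mul_div, div_le_iff₀ h1pg]; nlinarith
    refine ⟨fun l' h' => if l' = l ∧ h' = l + a then c * (1 - g) else 0, fun l' h' => ?_, fun l' h' hp => ?_,
      fun l' hl' hlow' => ?_, fun h' hh' habs => ?_⟩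
    · beta_reduce; split_ifs
      · exact mul_nonneg hc (by linarith)
      · exact le_rfl
    · beta_reduce at hp
      split_ifs at hp with hcase
      · obtain ⟨hl'eq, hh'eq⟩ := hcase
        rw [hl'eq, hh'eq]
        refine ⟨hlj, hlow, hlaN, ?_⟩
        by_cases hmid : j + 1 ≤ l + a
        · exact Or.inl hmid
        · right; push_cast
          have : (a : ℝ) * g < a := by nlinarith
          linarith
      · exact absurd hp (lt_irrefl 0)
    · -- rows
      beta_reduce
      have hne : l' ≠ l + a := by rintro rfl; exact htwin hlow'
      by_cases hl'l : l' = l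
      · rw [Finset.sum_eq_single (l + a)]
        · rw [if_pos ⟨hl'l, rfl⟩, if_neg hne, if_pos hl'l]; ring
        · intro h' _ hh'; rw [if_neg (fun hc' => hh' hc'.2)]
        · intro hn; exact absurd (Finset.mem_range.2 (Nat.lt_succ_of_le hlaN)) hn
      · rw [Finset.sum_eq_zero (fun h' _ => by rw [if_neg (fun hc' => hl'l hc'.1)])]
        rw [if_neg hne, if_neg hl'l]; ring
    · -- columns
      beta_reduce
      by_cases hh'la : h' = l + a
      · rw [hh'la, Finset.sum_eq_single l]
        · rw [if_pos ⟨rfl, rfl⟩, if_pos rfl, if_neg (by omega : l + a ≠ l)]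
          have := mul_le_mul_of_nonneg_left huse hc
          nlinarith [this]
        · intro l' _ hl'; rw [if_neg (fun hc' => hl' hc'.1), mul_zero]
        · intro hn; exact absurd (Finset.mem_range.2 (Nat.lt_succ_of_le hlj)) hn
      · rw [Finset.sum_eq_zero (fun l' _ => by rw [if_neg (fun hc' => hh'la hc'.2), mul_zero])]
        exact hTP0 h'

/-- shifted indicator sums: for `F` supported below `N`, `Σ_{l < N} F l·[h = l + a] = [a ≤ h]·F(h − a)`. [this work] -/
theorem sum_mul_indicator_shift (F : ℕ → ℝ) (N a h : ℕ) (hF : ∀ l, F l ≠ 0 → l < N) :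
    ∑ l ∈ Finset.range N, F l * (if h = l + a then (1 : ℝ) else 0) = if a ≤ h then F (h - a) else 0 := by
  by_cases hah : a ≤ h
  · rw [if_pos hah]
    have e : ∀ l ∈ Finset.range N, F l * (if h = l + a then (1 : ℝ) else 0) = if l = h - a then F l else 0 := by
      intro l _
      by_cases hl : l = h - a
      · rw [if_pos hl, if_pos (by omega), mul_one]
      · rw [if_neg hl, if_neg (by omega), mul_zero]
    rw [Finset.sum_congr rfl e, Finset.sum_ite_eq']
    by_cases hm : h - a ∈ Finset.range N
    · rw [if_pos hm]
    · rw [if_neg hm]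
      by_contra hne
      exact hm (Finset.mem_range.2 (hF _ (Ne.symm hne)))
  · rw [if_neg hah]
    exact Finset.sum_eq_zero fun l _ => by rw [if_neg (by omega), mul_zero]

end LawDec

end Quant

end Summit.CriticalPhenomena.PercolationContinuityZ3.Theorems
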